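import Literature.Topology.FourManifolds.TrisectionsSectorNormalForm

/-!
# Stub `stub_zoneMap` of line `lp-by-sphere-system-surgery` for crux `AgkCor6Sufficiency`
(item stmt-SmoothPoincare4-10894, routes CongruenceShadows / GroupTrisection; lead reshape r5)

**The zone map.**  Given normal frames `(u, v, ρ, U, O)` along `F ⊆ X` and `(u', v', ρ', U', O')`
along `F' ⊆ X'`, tubular zones `(Z, r, A)`, `(Z', r', A')` of the two frames (injectivity of
`(ρ, u, v)` on `Z`, the fibrewise translation `A` of the normal coordinates, jointly smooth) and a
homeomorphism `ψ : F ≃ F'` which, together with its inverse, is the restriction of a smooth map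
defined near `F` (resp. `F'`), the map `G x := A' (ψ (ρ x)) (u x, v x)` is, on the sub-zone
`{u² + v² < s²}`, `s := min r r'`, a diffeomorphism onto the corresponding sub-zone of `X'` with
inverse `Ginv y := A (ψ⁻¹ (ρ' y)) (u' y, v' y)`; it preserves the normal coordinates, intertwines
the retractions and restricts to `ψ` on `F`.  Proof: for `x ∈ Z` the point `ψ (ρ x) ∈ F' ⊆ Z'` has
normal coordinates `(0, 0)`, so the translation clause of `A'` applies with `p = (u x, v x)` as soon
as `u x² + v x² < s² ≤ r'²`; the identities `ρ' ∘ G = G ∘ ρ`, `G|F = ψ`, `Ginv ∘ G = id` are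
consequences of the injectivity of `(ρ, u, v)` on the zones; smoothness is the composition of the
jointly smooth `A'` with `x ↦ (Ψ (ρ x), (u x, v x))`.  This file declares the line's statement
`ZoneMap` and proves the registered stub `stub_zoneMap`.  References: Gay–Kirby, Geom. Topol. 20
(2016), Def. 1 [GayKirby2016]; Abrams–Gay–Kirby, Geom. Topol. 22 (2018), proof of Thm. 5
[AbramsGayKirby2018].
-/

noncomputable section

-- the prescribed namespace `Summit.<P>.<Sub>.…` duplicates `SmoothPoincare4` (P = Sub)
set_option linter.dupNamespace false

open Set Function ContinuousMap
open scoped Manifold ContDiff Topology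

namespace Summit.SmoothPoincare4.SmoothPoincare4.Cruxes.AgkCor6Sufficiency.LpBySphereSystemSurgery

open Literature.Topology.FourManifolds

/-! ## The statement -/

/-- **The zone map** (r5): given tubular zones of normal frames along `F ⊆ X`, `F' ⊆ X'` and a
homeomorphism `ψ : F ≃ F'` which, together with its inverse, is the restriction of a smooth map
defined near `F` (resp. `F'`), the map `G x := A' (ψ (ρ x)) (u x, v x)` is, on a sub-zone
`{u² + v² < s²}`, a diffeomorphism onto the corresponding sub-zone of `X'` with inverse
`Ginv y := A (ψ⁻¹ (ρ' y)) (u' y, v' y)`; it preserves the normal coordinates, intertwines the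
retractions, and restricts to `ψ` on `F`. -/
def ZoneMap : Prop :=
  ∀ (X : Type) [TopologicalSpace X] [T2Space X] [SecondCountableTopology X] [CompactSpace X]
    [ChartedSpace (EuclideanSpace ℝ (Fin 4)) X] [IsManifold (𝓡 4) ∞ X]
    (X' : Type) [TopologicalSpace X'] [T2Space X'] [SecondCountableTopology X'] [CompactSpace X']
    [ChartedSpace (EuclideanSpace ℝ (Fin 4)) X'] [IsManifold (𝓡 4) ∞ X']
    (F : Set X) (u v : X → ℝ) (ρ : X → X) (U O : Set X) (_ : NormalFrame F u v ρ U O)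
    (F' : Set X') (u' v' : X' → ℝ) (ρ' : X' → X') (U' O' : Set X')
    (_ : NormalFrame F' u' v' ρ' U' O')
    -- tubular zone of the frame on `X`
    (Z : Set X) (r : ℝ) (A : X → ℝ × ℝ → X) (_ : IsOpen Z) (_ : F ⊆ Z) (_ : Z ⊆ O)
    (_ : 0 < r)
    (_ : ∀ x ∈ Z, u x ^ 2 + v x ^ 2 < r ^ 2)
    (_ : ∀ x ∈ Z, ∀ y ∈ Z, ρ x = ρ y → u x = u y → v x = v y → x = y)
    (_ : ∀ x ∈ Z, ∀ p : ℝ × ℝ, (u x + p.1) ^ 2 + (v x + p.2) ^ 2 < r ^ 2 →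
        A x p ∈ Z ∧ ρ (A x p) = ρ x ∧ u (A x p) = u x + p.1 ∧ v (A x p) = v x + p.2)
    (_ : ContMDiffOn ((𝓡 4).prod 𝓘(ℝ, ℝ × ℝ)) (𝓡 4) ∞ (fun q : X × (ℝ × ℝ) => A q.1 q.2)
        {q | q.1 ∈ Z ∧ (u q.1 + q.2.1) ^ 2 + (v q.1 + q.2.2) ^ 2 < r ^ 2})
    -- tubular zone of the frame on `X'`
    (Z' : Set X') (r' : ℝ) (A' : X' → ℝ × ℝ → X') (_ : IsOpen Z') (_ : F' ⊆ Z') (_ : Z' ⊆ O')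
    (_ : 0 < r')
    (_ : ∀ y ∈ Z', u' y ^ 2 + v' y ^ 2 < r' ^ 2)
    (_ : ∀ x ∈ Z', ∀ y ∈ Z', ρ' x = ρ' y → u' x = u' y → v' x = v' y → x = y)
    (_ : ∀ y ∈ Z', ∀ p : ℝ × ℝ, (u' y + p.1) ^ 2 + (v' y + p.2) ^ 2 < r' ^ 2 →
        A' y p ∈ Z' ∧ ρ' (A' y p) = ρ' y ∧ u' (A' y p) = u' y + p.1 ∧ v' (A' y p) = v' y + p.2)
    (_ : ContMDiffOn ((𝓡 4).prod 𝓘(ℝ, ℝ × ℝ)) (𝓡 4) ∞ (fun q : X' × (ℝ × ℝ) => A' q.1 q.2)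
        {q | q.1 ∈ Z' ∧ (u' q.1 + q.2.1) ^ 2 + (v' q.1 + q.2.2) ^ 2 < r' ^ 2})
    -- the ambiently smooth homeomorphism of the corner strata
    (ψ : ↥F ≃ₜ ↥F') (Uψ : Set X) (Ψ : X → X') (_ : IsOpen Uψ) (_ : F ⊆ Uψ)
    (_ : ContMDiffOn (𝓡 4) (𝓡 4) ∞ Ψ Uψ) (_ : ∀ (x : X) (hx : x ∈ F), Ψ x = (ψ ⟨x, hx⟩ : X'))
    (Uψ' : Set X') (Ψ' : X' → X) (_ : IsOpen Uψ') (_ : F' ⊆ Uψ')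
    (_ : ContMDiffOn (𝓡 4) (𝓡 4) ∞ Ψ' Uψ')
    (_ : ∀ (y : X') (hy : y ∈ F'), Ψ' y = (ψ.symm ⟨y, hy⟩ : X)),
    ∃ (G : X → X') (Ginv : X' → X) (s : ℝ), 0 < s ∧ s ≤ r ∧ s ≤ r' ∧
      (∀ x ∈ Z, u x ^ 2 + v x ^ 2 < s ^ 2 →
        G x ∈ Z' ∧ u' (G x) = u x ∧ v' (G x) = v x ∧ ρ' (G x) = G (ρ x) ∧ Ginv (G x) = x) ∧
      (∀ y ∈ Z', u' y ^ 2 + v' y ^ 2 < s ^ 2 →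
        Ginv y ∈ Z ∧ u (Ginv y) = u' y ∧ v (Ginv y) = v' y ∧ ρ (Ginv y) = Ginv (ρ' y) ∧
          G (Ginv y) = y) ∧
      (∀ (x : X) (hx : x ∈ F), G x = (ψ ⟨x, hx⟩ : X')) ∧
      (∀ (y : X') (hy : y ∈ F'), Ginv y = (ψ.symm ⟨y, hy⟩ : X)) ∧
      ContMDiffOn (𝓡 4) (𝓡 4) ∞ G {x | x ∈ Z ∧ u x ^ 2 + v x ^ 2 < s ^ 2} ∧
      ContMDiffOn (𝓡 4) (𝓡 4) ∞ Ginv {y | y ∈ Z' ∧ u' y ^ 2 + v' y ^ 2 < s ^ 2}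

/-! ## Helpers -/

namespace ZoneMap

variable {X : Type*} [TopologicalSpace X] [ChartedSpace (EuclideanSpace ℝ (Fin 4)) X]
  {F : Set X} {u v : X → ℝ} {ρ : X → X} {U O : Set X}
  {Z : Set X} {r : ℝ} {A : X → ℝ × ℝ → X}

/-- Translating a point `y ∈ F` by `p` in the disc of radius `r` gives a point of `Z` over `y`
with normal coordinates `p`. -/
theorem translate_of_mem (hfr : NormalFrame F u v ρ U O) (hFZ : F ⊆ Z)
    (hA : ∀ x ∈ Z, ∀ p : ℝ × ℝ, (u x + p.1) ^ 2 + (v x + p.2) ^ 2 < r ^ 2 →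
      A x p ∈ Z ∧ ρ (A x p) = ρ x ∧ u (A x p) = u x + p.1 ∧ v (A x p) = v x + p.2)
    {y : X} (hy : y ∈ F) {p₁ p₂ : ℝ} (hp : p₁ ^ 2 + p₂ ^ 2 < r ^ 2) :
    A y (p₁, p₂) ∈ Z ∧ ρ (A y (p₁, p₂)) = y ∧ u (A y (p₁, p₂)) = p₁ ∧ v (A y (p₁, p₂)) = p₂ := by
  obtain ⟨hu0, hv0⟩ := (hfr.memF_iff y (hfr.F_subset_U hy)).1 hy
  obtain ⟨h1, h2, h3, h4⟩ := hA y (hFZ hy) (p₁, p₂) (by simpa [hu0, hv0] using hp)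
  exact ⟨h1, h2.trans (hfr.ρ_eq_self_of_mem hy), by simpa [hu0] using h3,
    by simpa [hv0] using h4⟩

/-- The zero translation fixes the points of `F`. -/
theorem translate_zero (hfr : NormalFrame F u v ρ U O) (hFZ : F ⊆ Z) (hr : 0 < r)
    (hZinj : ∀ x ∈ Z, ∀ y ∈ Z, ρ x = ρ y → u x = u y → v x = v y → x = y)
    (hA : ∀ x ∈ Z, ∀ p : ℝ × ℝ, (u x + p.1) ^ 2 + (v x + p.2) ^ 2 < r ^ 2 →
      A x p ∈ Z ∧ ρ (A x p) = ρ x ∧ u (A x p) = u x + p.1 ∧ v (A x p) = v x + p.2)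
    {y : X} (hy : y ∈ F) : A y (0, 0) = y := by
  obtain ⟨hu0, hv0⟩ := (hfr.memF_iff y (hfr.F_subset_U hy)).1 hy
  obtain ⟨h1, h2, h3, h4⟩ :=
    translate_of_mem hfr hFZ hA hy (p₁ := 0) (p₂ := 0) (by simpa using pow_pos hr 2)
  exact hZinj _ h1 _ (hFZ hy) (h2.trans (hfr.ρ_eq_self_of_mem hy).symm) (h3.trans hu0.symm)
    (h4.trans hv0.symm)

/-- A point of `Z` is the translate of its retraction by its normal coordinates. -/
theorem translate_ρ (hfr : NormalFrame F u v ρ U O) (hFZ : F ⊆ Z) (hZO : Z ⊆ O)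
    (hZr : ∀ x ∈ Z, u x ^ 2 + v x ^ 2 < r ^ 2)
    (hZinj : ∀ x ∈ Z, ∀ y ∈ Z, ρ x = ρ y → u x = u y → v x = v y → x = y)
    (hA : ∀ x ∈ Z, ∀ p : ℝ × ℝ, (u x + p.1) ^ 2 + (v x + p.2) ^ 2 < r ^ 2 →
      A x p ∈ Z ∧ ρ (A x p) = ρ x ∧ u (A x p) = u x + p.1 ∧ v (A x p) = v x + p.2)
    {x : X} (hx : x ∈ Z) : A (ρ x) (u x, v x) = x := by
  obtain ⟨h1, h2, h3, h4⟩ := translate_of_mem hfr hFZ hA (hfr.ρ_mem x (hZO hx)) (hZr x hx)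
  exact hZinj _ h1 _ hx h2 h3 h4

variable {X' : Type*} [TopologicalSpace X'] [ChartedSpace (EuclideanSpace ℝ (Fin 4)) X']
  {F' : Set X'} {u' v' : X' → ℝ} {ρ' : X' → X'} {U' O' : Set X'}
  {Z' : Set X'} {r' : ℝ} {A' : X' → ℝ × ℝ → X'}

/-- **The pointwise clause of the zone map** `G x := A' (Φ (ρ x)) (u x, v x)` with inverse
`Ginv y := A (Φ' (ρ' y)) (u' y, v' y)`, for maps `Φ`, `Φ'` with `Φ (F) ⊆ F'` and `Φ' ∘ Φ = id`
on `F`: on the sub-zone `{u² + v² < s²}`, `s² ≤ r'²`, the point `G x` lies in `Z'` with normal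
coordinates `(u x, v x)`, `ρ' (G x) = G (ρ x)` and `Ginv (G x) = x`. -/
theorem clause (hfr : NormalFrame F u v ρ U O) (hfr' : NormalFrame F' u' v' ρ' U' O')
    (hFZ : F ⊆ Z) (hZO : Z ⊆ O) (hZr : ∀ x ∈ Z, u x ^ 2 + v x ^ 2 < r ^ 2)
    (hZinj : ∀ x ∈ Z, ∀ y ∈ Z, ρ x = ρ y → u x = u y → v x = v y → x = y)
    (hA : ∀ x ∈ Z, ∀ p : ℝ × ℝ, (u x + p.1) ^ 2 + (v x + p.2) ^ 2 < r ^ 2 →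
      A x p ∈ Z ∧ ρ (A x p) = ρ x ∧ u (A x p) = u x + p.1 ∧ v (A x p) = v x + p.2)
    (hFZ' : F' ⊆ Z') (hr' : 0 < r')
    (hZinj' : ∀ x ∈ Z', ∀ y ∈ Z', ρ' x = ρ' y → u' x = u' y → v' x = v' y → x = y)
    (hA' : ∀ y ∈ Z', ∀ p : ℝ × ℝ, (u' y + p.1) ^ 2 + (v' y + p.2) ^ 2 < r' ^ 2 →
      A' y p ∈ Z' ∧ ρ' (A' y p) = ρ' y ∧ u' (A' y p) = u' y + p.1 ∧ v' (A' y p) = v' y + p.2)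
    {Φ : X → X'} {Φ' : X' → X} (hΦ : ∀ x ∈ F, Φ x ∈ F') (hΦ'Φ : ∀ x ∈ F, Φ' (Φ x) = x)
    {s : ℝ} (hs : s ^ 2 ≤ r' ^ 2) {x : X} (hx : x ∈ Z) (hxs : u x ^ 2 + v x ^ 2 < s ^ 2) :
    A' (Φ (ρ x)) (u x, v x) ∈ Z' ∧ u' (A' (Φ (ρ x)) (u x, v x)) = u x ∧
      v' (A' (Φ (ρ x)) (u x, v x)) = v x ∧
      ρ' (A' (Φ (ρ x)) (u x, v x)) = A' (Φ (ρ (ρ x))) (u (ρ x), v (ρ x)) ∧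
      A (Φ' (ρ' (A' (Φ (ρ x)) (u x, v x))))
        (u' (A' (Φ (ρ x)) (u x, v x)), v' (A' (Φ (ρ x)) (u x, v x))) = x := by
  have hxO : x ∈ O := hZO hx
  have hρF : ρ x ∈ F := hfr.ρ_mem x hxO
  have hyF' : Φ (ρ x) ∈ F' := hΦ _ hρF
  obtain ⟨h1, h2, h3, h4⟩ := translate_of_mem hfr' hFZ' hA' hyF' (hxs.trans_le hs)
  refine ⟨h1, h3, h4, ?_, ?_⟩
  · rw [h2, hfr.ρ_ρ hxO, hfr.u_ρ hxO, hfr.v_ρ hxO]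
    exact (translate_zero hfr' hFZ' hr' hZinj' hA' hyF').symm
  · rw [h2, h3, h4, hΦ'Φ _ hρF]
    exact translate_ρ hfr hFZ hZO hZr hZinj hA hx

/-- **Smoothness of the zone map** on the sub-zone `{u² + v² < s²}`, `s² ≤ r'²`: the composition
of the jointly smooth translation `A'` with the smooth `x ↦ (Φ (ρ x), (u x, v x))`. -/
theorem contMDiffOn_zoneMap (hfr : NormalFrame F u v ρ U O)
    (hfr' : NormalFrame F' u' v' ρ' U' O') (hZO : Z ⊆ O) (hFZ' : F' ⊆ Z')
    (hAs' : ContMDiffOn ((𝓡 4).prod 𝓘(ℝ, ℝ × ℝ)) (𝓡 4) ∞ (fun q : X' × (ℝ × ℝ) => A' q.1 q.2)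
      {q | q.1 ∈ Z' ∧ (u' q.1 + q.2.1) ^ 2 + (v' q.1 + q.2.2) ^ 2 < r' ^ 2})
    {Φ : X → X'} {UΦ : Set X} (hFU : F ⊆ UΦ) (hΦs : ContMDiffOn (𝓡 4) (𝓡 4) ∞ Φ UΦ)
    (hΦ : ∀ x ∈ F, Φ x ∈ F') {s : ℝ} (hs : s ^ 2 ≤ r' ^ 2) :
    ContMDiffOn (𝓡 4) (𝓡 4) ∞ (fun x => A' (Φ (ρ x)) (u x, v x))
      {x | x ∈ Z ∧ u x ^ 2 + v x ^ 2 < s ^ 2} := by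
  have h1 : ContMDiffOn (𝓡 4) (𝓡 4) ∞ (fun x => Φ (ρ x))
      {x | x ∈ Z ∧ u x ^ 2 + v x ^ 2 < s ^ 2} :=
    hΦs.comp hfr.contMDiff_ρ.contMDiffOn fun x hx => hFU (hfr.ρ_mem x (hZO hx.1))
  have h2 : ContMDiff (𝓡 4) 𝓘(ℝ, ℝ × ℝ) ∞ fun x => (u x, v x) :=
    hfr.contMDiff_u.prodMk_space hfr.contMDiff_v
  refine hAs'.comp (h1.prodMk h2.contMDiffOn) fun x hx => ?_
  have hyF' : Φ (ρ x) ∈ F' := hΦ _ (hfr.ρ_mem x (hZO hx.1))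
  obtain ⟨hu0, hv0⟩ := (hfr'.memF_iff _ (hfr'.F_subset_U hyF')).1 hyF'
  refine ⟨hFZ' hyF', ?_⟩
  show (u' (Φ (ρ x)) + u x) ^ 2 + (v' (Φ (ρ x)) + v x) ^ 2 < r' ^ 2
  rw [hu0, hv0, zero_add, zero_add]
  exact hx.2.trans_le hs

end ZoneMap

open ZoneMap in
/-- **stub — zone map** (r5): `G x := A' (Ψ (ρ x)) (u x, v x)`,
`Ginv y := A (Ψ' (ρ' y)) (u' y, v' y)` and `s := min r r'`. -/
theorem stub_zoneMap : ZoneMap := by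
  intro X _ _ _ _ _ _ X' _ _ _ _ _ _ F u v ρ U O hfr F' u' v' ρ' U' O' hfr' Z r A _hZo hFZ hZO hr
    hZr hZinj hA hAs Z' r' A' _hZo' hFZ' hZO' hr' hZr' hZinj' hA' hAs' ψ Uψ Ψ _hUψo hFUψ hΨs hΨF
    Uψ' Ψ' _hUψo' hFUψ' hΨs' hΨF'
  -- `Ψ` maps `F` into `F'`, `Ψ'` maps `F'` into `F`, and they are mutually inverse there
  have hΨmem : ∀ x ∈ F, Ψ x ∈ F' := fun x hx => by rw [hΨF x hx]; exact (ψ ⟨x, hx⟩).2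
  have hΨ'mem : ∀ y ∈ F', Ψ' y ∈ F := fun y hy => by rw [hΨF' y hy]; exact (ψ.symm ⟨y, hy⟩).2
  have hΨ'Ψ : ∀ x ∈ F, Ψ' (Ψ x) = x := fun x hx => by
    rw [hΨF x hx, hΨF' _ (ψ ⟨x, hx⟩).2, Subtype.coe_eta, ψ.symm_apply_apply]
  have hΨΨ' : ∀ y ∈ F', Ψ (Ψ' y) = y := fun y hy => by
    rw [hΨF' y hy, hΨF _ (ψ.symm ⟨y, hy⟩).2, Subtype.coe_eta, ψ.apply_symm_apply]
  -- the radius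
  have hs : 0 < min r r' := lt_min hr hr'
  have hsr : min r r' ^ 2 ≤ r ^ 2 := pow_le_pow_left₀ hs.le (min_le_left r r') 2
  have hsr' : min r r' ^ 2 ≤ r' ^ 2 := pow_le_pow_left₀ hs.le (min_le_right r r') 2
  refine ⟨fun x => A' (Ψ (ρ x)) (u x, v x), fun y => A (Ψ' (ρ' y)) (u' y, v' y), min r r', hs,
    min_le_left r r', min_le_right r r', ?_, ?_, ?_, ?_, ?_, ?_⟩
  · intro x hx hxs
    exact clause hfr hfr' hFZ hZO hZr hZinj hA hFZ' hr' hZinj' hA' hΨmem hΨ'Ψ hsr' hx hxs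
  · intro y hy hys
    exact clause hfr' hfr hFZ' hZO' hZr' hZinj' hA' hFZ hr hZinj hA hΨ'mem hΨΨ' hsr hy hys
  · intro x hx
    obtain ⟨hu0, hv0⟩ := (hfr.memF_iff x (hfr.F_subset_U hx)).1 hx
    show A' (Ψ (ρ x)) (u x, v x) = _
    rw [hfr.ρ_eq_self_of_mem hx, hu0, hv0, ← hΨF x hx]
    exact translate_zero hfr' hFZ' hr' hZinj' hA' (hΨmem x hx)
  · intro y hy
    obtain ⟨hu0, hv0⟩ := (hfr'.memF_iff y (hfr'.F_subset_U hy)).1 hy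
    show A (Ψ' (ρ' y)) (u' y, v' y) = _
    rw [hfr'.ρ_eq_self_of_mem hy, hu0, hv0, ← hΨF' y hy]
    exact translate_zero hfr hFZ hr hZinj hA (hΨ'mem y hy)
  · exact contMDiffOn_zoneMap hfr hfr' hZO hFZ' hAs' hFUψ hΨs hΨmem hsr'
  · exact contMDiffOn_zoneMap hfr' hfr hZO' hFZ hAs hFUψ' hΨs' hΨ'mem hsr

end Summit.SmoothPoincare4.SmoothPoincare4.Cruxes.AgkCor6Sufficiency.LpBySphereSystemSurgery

end
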